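/-
COR-CM (cells pub-hodgecm / pub-hodgecm2, stage 2 of the Hodge ladder) — TRANSPOSITION, item (vi) sub-binder S2, PINNING RECORD, REACH
HALF: TEAM hComp (`HOME/pinning/HCOMP-TABLE.md`), seat hcomp-abcm-1 (rows A0/A1/A1′: the Albanese leaf).  Path under the
pub-hodgecm2 lead's blanket for `Transposition/HComp/<Name>.lean` (custody hcomp-lead).  THEOREMS ONLY: no definition, no instance,
no named fact, no `variable`, no proof holes; nothing in the tree is edited or restated; pin-1's `Transposition/Item6PinReachAlong.lean`
is NOT imported.  FRAMING: HC_CM is NOT proved; this file discharges NO binder of the COR-CM closed term by itself — it proves,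
WITHOUT the named fact `Liu2021.albanese_baseChange_isLimit_fan_jacobian`, the JOINTLY-EPIMORPHIC weakening of the binder `hAlb`,
which is all that the tree consumer of `hAlb` (`Item6PinReach.lean`, `CMReach.exists_inj_comp_ne_zero`) uses.
-/
import Summits.HodgeConjecture.CorCM.CM.Basic
import Literature.NumberTheory.Automorphic.Liu2021.AlbaneseBaseChangeJointlyEpi
import HarnessLib

/-!
# Item (vi) S2, binder `hAlb` of the pinned REACH junction in JOINTLY-EPIMORPHIC form — a THEOREM, no cite

pin-1's `Model.hComp_of_unif_of_alb_along` (`Transposition/Item6PinReachAlong.lean`) splits the READING binder `hComp` into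
`hUnif` and `hAlb`; `hAlb` asks, for every decomposition of `X_{K'} ⊗_{E, e ι₁} ℂ` into smooth projective geometrically
irreducible surfaces `X c`, for Albanese data `𝒥 c` and a PRODUCT decomposition `A_{K'} ⊗_{E, e ι₁} ℂ ≅ ∏_c J(X_c)` (a limit
fan) — proved in `HComp/HAlbHolds.lean` from the NAMED FACT `Liu2021.albanese_baseChange_isLimit_fan_jacobian` ([Liu2021 §2.1]
with Grothendieck's base-change theorem for the Albanese, FGA VI 3.3 (iii)).  Downstream that product is used ONLY through
«a non-zero homomorphism `A_{K'} ⊗ ℂ ⟶ A_μ` is non-zero on some factor `J(X_c)`» (`Item6PinReach.lean`,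
`Model.pinReach_of_componentPin`, via `CMReach.exists_inj_comp_ne_zero`).  This file proves that weaker clause OUTRIGHT:

* `Model.hAlbEpi_holds (e) (P5) (iso) (C)` — for every admissible face, every pin embedding `e F ι₁`, every small level `K'`,
  and every finite coproduct decomposition `X c ⟶ X_{K'} ⊗_{E, e ι₁} ℂ` into smooth projective geometrically irreducible
  surfaces: Albanese data `𝒥 c : Jacobian (X c)` and homomorphisms `ι c : J(X_c) ⟶ A_{K'} ⊗_{E, e ι₁} ℂ` such that every
  non-zero `w : A_{K'} ⊗_{E, e ι₁} ℂ ⟶ B` has `ι c ≫ w ≠ 0` for some `c`.  NO named-fact hypothesis.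
* `Model.hAlbEpi_holds_conj` — the instance of record (package P2′: `e F ι₁ := (starRingEnd ℂ).comp ι₁`);
* `Model.hAlbEpi_holds_id` — the in-tree instance `e = id` (package P1).

Source of the proof: `Literature/NumberTheory/Automorphic/Liu2021/AlbaneseBaseChangeJointlyEpi.lean`
(`Albanese.exists_jacobian_hom_baseChange_of_ne_zero_of_isProjectiveOver`: finite Galois splitting with pointed pieces,
Galois descent of Liu's datum WITH its comparison isomorphism, uniqueness of the corepresenting object, Serre's «a generating
map forces surjectivity» along `L → ℂ`, matching of connected components), instantiated EXACTLY as `HAlbHolds.lean`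
instantiates the named fact: `k := F`, `σ := e F ι₁`, `X := (C F ι₁ V Φ).X K'` (projective: `CompactifiedSystem.projective_X`;
smooth: `CompactifiedSystem.smooth_X`, [Liu2021 §4.2 l. 2064]), `a := (C F ι₁ V Φ).alb K'` (`a.Alb = A_{K'}` by `rfl`),
`n := 2`.  The face guards are not used.  T5: n/a (no `Prop` binder).  HC_CM is NOT proved.

References: Y. Liu, arXiv:2102.11518 (`FJcycle.tex`): §2.1 Proposition l. 1190–1200, Def. 2.3, Lemma 2.4 (1) l. 1211–1228;
§4.2 l. 2060–2066.  D. Mumford, *Abelian Varieties* §19 Thm. 1 Cor. 1.  J.-P. Serre, Sém. Chevalley 4, exp. 10, no. 2.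
-/

noncomputable section

namespace Summit.HodgeConjecture.CorCM.Model

open CategoryTheory CategoryTheory.Limits AlgebraicGeometry NumberField
open Literature.AlgebraicGeometry.Motives
open Literature.NumberTheory.Automorphic.Liu2021
open Literature.NumberTheory.Automorphic.Liu2021.AppendixC

/-- **`hAlb` in jointly-epimorphic form HOLDS — no named fact.**  For EVERY pin embedding `e` and ALL carriers `P5 iso C`:
for every admissible face `(F, Φ, ι₁ ∈ Φ, V)`, small level `K'` and finite coproduct decomposition
`inj c : X c ⟶ X_{K'} ⊗_{E, e ι₁} ℂ` into smooth projective geometrically irreducible surfaces, there are Albanese data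
`𝒥 c : Jacobian (X c)` and homomorphisms `ι c : J(X_c) ⟶ A_{K'} ⊗_{E, e ι₁} ℂ` which are jointly epimorphic: every non-zero
`w : A_{K'} ⊗_{E, e ι₁} ℂ ⟶ B` has `ι c ≫ w ≠ 0` for some `c`.  Instantiation of
`Albanese.exists_jacobian_hom_baseChange_of_ne_zero_of_isProjectiveOver` at `k := F`, `σ := e F ι₁`,
`X := (C F ι₁ V Φ).X K'`, `a := (C F ι₁ V Φ).alb K'`, `n := 2`; the face guards are not used.  Ours; HC_CM is NOT proved.
[cite: Liu2021, §2.1 Proposition (FJcycle.tex l. 1190–1200), Lemma 2.4 (1) (l. 1220–1228), §4.2 l. 2060–2066] -/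
theorem hAlbEpi_holds
    (e : ∀ (F : CMField), (F →+* ℂ) → (F →+* ℂ))
    (P5 : ∀ (F : CMField) (ι₁ : F →+* ℂ) (_ : HermSpace3 F ι₁) (_ : CMType F), PropC5Data (maximalRealSubfield F) F)
    (iso : ∀ (F : CMField) (ι₁ : F →+* ℂ) (_ : HermSpace3 F ι₁) (_ : CMType F), ℕ → Prop)
    (C : ∀ (F : CMField) (ι₁ : F →+* ℂ) (V : HermSpace3 F ι₁) (Φ : CMType F), Sec42Data (P5 F ι₁ V Φ) (iso F ι₁ V Φ)) :
    ∀ (F : CMField), IsGalois ℚ F → 6 ≤ Module.finrank ℚ F → ∀ (Φ : CMType F) (ι₁ : F →+* ℂ), ι₁ ∈ Φ.1 →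
      ∀ (V : HermSpace3 F ι₁) (K' : C5.SmallLevel (C F ι₁ V Φ).S.K₀) (Cset : Type) (_ : Fintype Cset) (X : Cset → SchemeOver ℂ)
        (inj : ∀ c, X c ⟶ (baseChangeHom (e F ι₁)).obj ((C F ι₁ V Φ).X K')),
        (∀ c, IsSmoothProjective 2 (X c)) → Nonempty (IsColimit (Cofan.mk _ inj)) →
          ∃ (𝒥 : ∀ c, Jacobian (X c))
            (ι : ∀ c, (𝒥 c).J ⟶ (letI := (e F ι₁).toAlgebra; ((C F ι₁ V Φ).A K').baseChange ℂ)),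
            ∀ (B : AbelianVariety ℂ) (w : (letI := (e F ι₁).toAlgebra; ((C F ι₁ V Φ).A K').baseChange ℂ) ⟶ B),
              w ≠ 0 → ∃ c, ι c ≫ w ≠ 0 := by
  intro F _ _ Φ ι₁ _ V K' Cset _ X inj hX hcol
  exact Albanese.exists_jacobian_hom_baseChange_of_ne_zero_of_isProjectiveOver (e F ι₁) ((C F ι₁ V Φ).X K')
    ((C F ι₁ V Φ).cpt.projective_X K') ((C F ι₁ V Φ).cpt.smooth_X K') ((C F ι₁ V Φ).alb K') 2 X inj hX hcol

/-- The instance of record (package P2′, HCOMP-TABLE §0): `e F ι₁ := (starRingEnd ℂ).comp ι₁`, all binder types spelled out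
at that literal `e`.  No named fact.  HC_CM is NOT proved. [cite: Liu2021, §2.1 Proposition and Lemma 2.4 (1)] -/
theorem hAlbEpi_holds_conj
    (P5 : ∀ (F : CMField) (ι₁ : F →+* ℂ) (_ : HermSpace3 F ι₁) (_ : CMType F), PropC5Data (maximalRealSubfield F) F)
    (iso : ∀ (F : CMField) (ι₁ : F →+* ℂ) (_ : HermSpace3 F ι₁) (_ : CMType F), ℕ → Prop)
    (C : ∀ (F : CMField) (ι₁ : F →+* ℂ) (V : HermSpace3 F ι₁) (Φ : CMType F), Sec42Data (P5 F ι₁ V Φ) (iso F ι₁ V Φ)) :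
    ∀ (F : CMField), IsGalois ℚ F → 6 ≤ Module.finrank ℚ F → ∀ (Φ : CMType F) (ι₁ : F →+* ℂ), ι₁ ∈ Φ.1 →
      ∀ (V : HermSpace3 F ι₁) (K' : C5.SmallLevel (C F ι₁ V Φ).S.K₀) (Cset : Type) (_ : Fintype Cset) (X : Cset → SchemeOver ℂ)
        (inj : ∀ c, X c ⟶ (baseChangeHom ((starRingEnd ℂ).comp ι₁)).obj ((C F ι₁ V Φ).X K')),
        (∀ c, IsSmoothProjective 2 (X c)) → Nonempty (IsColimit (Cofan.mk _ inj)) →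
          ∃ (𝒥 : ∀ c, Jacobian (X c))
            (ι : ∀ c, (𝒥 c).J ⟶ (letI := ((starRingEnd ℂ).comp ι₁).toAlgebra; ((C F ι₁ V Φ).A K').baseChange ℂ)),
            ∀ (B : AbelianVariety ℂ)
              (w : (letI := ((starRingEnd ℂ).comp ι₁).toAlgebra; ((C F ι₁ V Φ).A K').baseChange ℂ) ⟶ B),
              w ≠ 0 → ∃ c, ι c ≫ w ≠ 0 :=
  hAlbEpi_holds (fun _ ι₁ => (starRingEnd ℂ).comp ι₁) P5 iso C

/-- The in-tree instance `e = id` (package P1: the pin of `Model.hComp_of_unif_of_alb`, `Transposition/Item6PinReachGlue.lean`).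
No named fact.  HC_CM is NOT proved. [cite: Liu2021, §2.1 Proposition and Lemma 2.4 (1)] -/
theorem hAlbEpi_holds_id
    (P5 : ∀ (F : CMField) (ι₁ : F →+* ℂ) (_ : HermSpace3 F ι₁) (_ : CMType F), PropC5Data (maximalRealSubfield F) F)
    (iso : ∀ (F : CMField) (ι₁ : F →+* ℂ) (_ : HermSpace3 F ι₁) (_ : CMType F), ℕ → Prop)
    (C : ∀ (F : CMField) (ι₁ : F →+* ℂ) (V : HermSpace3 F ι₁) (Φ : CMType F), Sec42Data (P5 F ι₁ V Φ) (iso F ι₁ V Φ)) :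
    ∀ (F : CMField), IsGalois ℚ F → 6 ≤ Module.finrank ℚ F → ∀ (Φ : CMType F) (ι₁ : F →+* ℂ), ι₁ ∈ Φ.1 →
      ∀ (V : HermSpace3 F ι₁) (K' : C5.SmallLevel (C F ι₁ V Φ).S.K₀) (Cset : Type) (_ : Fintype Cset) (X : Cset → SchemeOver ℂ)
        (inj : ∀ c, X c ⟶ (baseChangeHom ι₁).obj ((C F ι₁ V Φ).X K')),
        (∀ c, IsSmoothProjective 2 (X c)) → Nonempty (IsColimit (Cofan.mk _ inj)) →
          ∃ (𝒥 : ∀ c, Jacobian (X c)) (ι : ∀ c, (𝒥 c).J ⟶ (letI := ι₁.toAlgebra; ((C F ι₁ V Φ).A K').baseChange ℂ)),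
            ∀ (B : AbelianVariety ℂ) (w : (letI := ι₁.toAlgebra; ((C F ι₁ V Φ).A K').baseChange ℂ) ⟶ B),
              w ≠ 0 → ∃ c, ι c ≫ w ≠ 0 :=
  hAlbEpi_holds (fun _ ι₁ => ι₁) P5 iso C

end Summit.HodgeConjecture.CorCM.Model

end
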